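import Mathlib.Algebra.Group.Subgroup.Finite
import Mathlib.GroupTheory.Index
import Mathlib.Data.Nat.Log
import Mathlib.Tactic.Ring
import HarnessLib

/-!
# Strictly increasing chains of subgroups of a finite group have length `≤ log₂ #G`

If `H₀ < H₁ < ⋯ < H_k` are subgroups of a finite group `G` then `2^k · #H₀ ≤ #H_k`, hence
`2^k ≤ #G` and `k ≤ ⌊log₂ #G⌋` (`two_pow_mul_card_le_of_chain`, `two_pow_le_card_of_chain`,
`length_le_log_card_of_chain`): each proper inclusion at least doubles the order (Lagrange).
This is the bound "the longest strictly increasing chain of proper subgroups of `C_Δ` has length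
at most `[(log |Δ|)/log 2]`" used by Lenstra–Pomerance, *A rigorous time bound for factoring
integers*, J. Amer. Math. Soc. **5** (1992), proof of Theorem 4.5 (p. 497), to bound the expected
number of random prime forms needed to generate the class group; it is recorded here in general
form. Everything is proved.

## References

* H. W. Lenstra Jr., C. Pomerance, J. Amer. Math. Soc. 5 (1992) 483–516, §4, proof of Thm 4.5.
  [LenstraPomerance1992]
-/

namespace Literature.GroupTheory.FiniteAbelian

variable {G : Type*} [Group G] [Finite G]

/-- A proper inclusion of subgroups of a finite group at least doubles the order (Lagrange:
`#H ∣ #K` and `#H ≠ #K`). [folklore] -/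
theorem two_mul_card_le_of_lt {H K : Subgroup G} (h : H < K) : 2 * Nat.card H ≤ Nat.card K := by
  obtain ⟨c, hc⟩ := Subgroup.card_dvd_of_le h.le
  have hH : 0 < Nat.card H := Nat.card_pos
  have hK : 0 < Nat.card K := Nat.card_pos
  have hne : Nat.card H ≠ Nat.card K := fun heq =>
    h.ne (Subgroup.eq_of_le_of_card_ge h.le heq.ge)
  have hc0 : c ≠ 0 := by
    rintro rfl
    rw [mul_zero] at hc
    omega
  have hc1 : c ≠ 1 := by
    rintro rfl
    rw [mul_one] at hc
    exact hne hc.symm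
  have hc2 : 2 ≤ c := by omega
  calc 2 * Nat.card H ≤ c * Nat.card H := Nat.mul_le_mul_right _ hc2
    _ = Nat.card K := by rw [hc, mul_comm]

/-- **Chains of subgroups.** If `H 0 < H 1 < ⋯ < H k` are subgroups of a finite group then
`2 ^ k · #(H 0) ≤ #(H k)`. [cite: LenstraPomerance1992, §4 proof of Thm 4.5] -/
theorem two_pow_mul_card_le_of_chain (H : ℕ → Subgroup G) {k : ℕ}
    (hH : ∀ i < k, H i < H (i + 1)) : 2 ^ k * Nat.card (H 0) ≤ Nat.card (H k) := by
  induction k with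
  | zero => simp
  | succ k ih =>
    have h1 := ih fun i hi => hH i (Nat.lt_succ_of_lt hi)
    have h2 := two_mul_card_le_of_lt (hH k (Nat.lt_succ_self k))
    calc 2 ^ (k + 1) * Nat.card (H 0) = 2 * (2 ^ k * Nat.card (H 0)) := by ring
      _ ≤ 2 * Nat.card (H k) := Nat.mul_le_mul_left 2 h1
      _ ≤ Nat.card (H (k + 1)) := h2

/-- Hence `2 ^ k ≤ #G` for a strictly increasing chain of `k + 1` subgroups.
[cite: LenstraPomerance1992, §4 proof of Thm 4.5] -/
theorem two_pow_le_card_of_chain (H : ℕ → Subgroup G) {k : ℕ} (hH : ∀ i < k, H i < H (i + 1)) :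
    2 ^ k ≤ Nat.card G := by
  have h1 := two_pow_mul_card_le_of_chain H hH
  have h0 : 0 < Nat.card (H 0) := Nat.card_pos
  calc 2 ^ k ≤ 2 ^ k * Nat.card (H 0) := Nat.le_mul_of_pos_right _ h0
    _ ≤ Nat.card (H k) := h1
    _ ≤ Nat.card G := Subgroup.card_le_card_group (H k)

/-- And the length of the chain is at most `⌊log₂ #G⌋` (for the class group `C_Δ`, with
`#C_Δ < |Δ|`, at most `[(log |Δ|)/log 2]`). [cite: LenstraPomerance1992, §4 proof of Thm 4.5] -/
theorem length_le_log_card_of_chain (H : ℕ → Subgroup G) {k : ℕ}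
    (hH : ∀ i < k, H i < H (i + 1)) : k ≤ Nat.log 2 (Nat.card G) :=
  Nat.le_log_of_pow_le one_lt_two (two_pow_le_card_of_chain H hH)

end Literature.GroupTheory.FiniteAbelian
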